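import Summits.QuantumAdvantage.AdviceFreeQNC0.FibreDecimation37Twist
import HarnessLib

/-!
# Cell qa-qnc0, `p = 3` — ROUND-37P2 §3.8 (ii), File E toolkit: Fourier analysis on the LABEL GROUP `𝔽₃^R` and the twisted character
# expansion of a product of MOD-3 tests TIMES an arbitrary function of `R` label forms

Planner qa-qnc0-p2 g37, ROUND-37P2 §3.8 (ii) / §6 File E ("the `h`-part carried through `L_a` as a function of the label values, then STEP 3′
with Parseval on `𝔽₃^{J'} × 𝔽₃^R`").  Over the tree's `TwoModuli.sum_stdAddChar_dot_eq_ite` (orthogonality on `(ℤ/p)^K`) and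
`TwoModuli.norm_cubeSum_eq`:

* `lcoef H γ = 3^{−R} Σ_v H(v) χ₃(−⟨γ,v⟩)`, `label_inversion` (`H(v) = Σ_γ lcoef_γ χ₃(⟨γ,v⟩)`), `norm_lcoef_le` (`≤ 3^{−R}Σ|H|`),
  **`sum_norm_sq_lcoef`** (Parseval: `Σ_γ |lcoef_γ|² = 1` for a `±1`-valued `H`);
* `subsetSum_add` and **`norm_sum_prod_label_twist_le`**: with `h_k = Σ_s a_{k,s}χ₃(s·)` and `H = Σ_γ b_γ χ₃(⟨γ,·⟩)`,
  `‖Σ_u ∏_k h_k(ℓ_k(u)) · H((L_i(u))_i) · χ₂(t)^{|u|}‖ ≤ Σ_{(s,γ)} (∏_k‖a_{k,s_k}‖)‖b_γ‖ · ∏_c ‖1 + χ₃(λ(s)_c + Λ(γ)_c)χ₂(t)‖`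
  (`λ(s) = Σ_k s_kδ_k`, `Λ(γ) = Σ_i γ_i S_i`).

Standard discrete Fourier analysis; the cell's packaging.  WHAT THIS IS NOT: the count and the game statement are in the sequels.
-/

noncomputable section

namespace Summit.QuantumAdvantage.AdviceFreeQNC0.Exp37

open Finset ZMod
open Literature.Computability.MetaComplexity Literature.Computability.MetaComplexity.ModTestProduct
open Literature.Computability.MetaComplexity.TwoModuli

/-! ### Fourier coefficients on the label group `𝔽₃^R` -/

section Label

variable {R : ℕ}

/-- Fourier coefficient on `𝔽₃^R`: `lcoef H γ = 3^{−R} Σ_v H(v) χ₃(−Σ_j γ_j v_j)`. -/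
def lcoef (H : (Fin R → ZMod 3) → ℂ) (γ : Fin R → ZMod 3) : ℂ :=
  ((3 : ℂ) ^ R)⁻¹ * ∑ v : Fin R → ZMod 3, H v * stdAddChar (-∑ j, γ j * v j)

/-- **Fourier inversion on `𝔽₃^R`**: `H(v) = Σ_γ lcoef_γ · χ₃(Σ_j γ_j v_j)`. -/
theorem label_inversion (H : (Fin R → ZMod 3) → ℂ) (v : Fin R → ZMod 3) :
    H v = ∑ γ : Fin R → ZMod 3, lcoef H γ * stdAddChar (∑ j, γ j * v j) := by
  classical
  have hind : H v = ∑ r : Fin R → ZMod 3, (if v = r then (1 : ℂ) else 0) * H r := by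
    rw [Finset.sum_eq_single v]
    · simp
    · intro r _ hr; rw [if_neg (Ne.symm hr), zero_mul]
    · intro hv; exact absurd (mem_univ v) hv
  rw [hind]
  have hterm : ∀ r : Fin R → ZMod 3, (if v = r then (1 : ℂ) else 0) * H r =
      ∑ γ : Fin R → ZMod 3, ((3 : ℂ) ^ R)⁻¹ * (H r * stdAddChar (-∑ j, γ j * r j)) * stdAddChar (∑ j, γ j * v j) := by
    intro r
    have h := ite_eq_eq_sum_stdAddChar (p := 3) v r
    push_cast at h
    rw [h, mul_sum, sum_mul]
    refine sum_congr rfl fun γ _ => ?_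
    have hsplit : (stdAddChar (∑ j, γ j * (v j - r j)) : ℂ) =
        stdAddChar (∑ j, γ j * v j) * stdAddChar (-∑ j, γ j * r j) := by
      rw [← AddChar.map_add_eq_mul]
      congr 1
      rw [← sub_eq_add_neg, ← sum_sub_distrib]
      exact sum_congr rfl fun j _ => by ring
    rw [hsplit]; ring
  simp_rw [hterm]
  rw [sum_comm]
  refine sum_congr rfl fun γ _ => ?_
  unfold lcoef
  rw [mul_sum, sum_mul]

/-- `‖lcoef_γ‖ ≤ 1` for a `±1`-valued `H`. -/
theorem norm_lcoef_le_one (H : (Fin R → ZMod 3) → ℂ) (hsign : ∀ v, H v = 1 ∨ H v = -1) (γ : Fin R → ZMod 3) :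
    ‖lcoef H γ‖ ≤ 1 := by
  unfold lcoef
  rw [norm_mul, norm_inv, norm_pow]
  have h3 : ‖(3 : ℂ)‖ = 3 := by simp
  rw [h3]
  have hsum : ‖∑ v : Fin R → ZMod 3, H v * (stdAddChar (-∑ j, γ j * v j) : ℂ)‖ ≤ (3 : ℝ) ^ R := by
    calc ‖∑ v : Fin R → ZMod 3, H v * (stdAddChar (-∑ j, γ j * v j) : ℂ)‖
        ≤ ∑ v : Fin R → ZMod 3, ‖H v * (stdAddChar (-∑ j, γ j * v j) : ℂ)‖ := norm_sum_le _ _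
      _ = ∑ _v : Fin R → ZMod 3, (1 : ℝ) := by
          refine sum_congr rfl fun v _ => ?_
          rw [norm_mul, ZMod.stdAddChar_apply, Circle.norm_coe, mul_one]
          rcases hsign v with h | h <;> rw [h] <;> simp
      _ = (3 : ℝ) ^ R := by simp
  have hpos : (0 : ℝ) < (3 : ℝ) ^ R := by positivity
  calc ((3 : ℝ) ^ R)⁻¹ * ‖∑ v : Fin R → ZMod 3, H v * (stdAddChar (-∑ j, γ j * v j) : ℂ)‖
      ≤ ((3 : ℝ) ^ R)⁻¹ * (3 : ℝ) ^ R := mul_le_mul_of_nonneg_left hsum (by positivity)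
    _ = 1 := inv_mul_cancel₀ hpos.ne'

/-- **Parseval on `𝔽₃^R` for a `±1`-valued function**: `Σ_γ ‖lcoef_γ‖² = 1`. -/
theorem sum_norm_sq_lcoef (H : (Fin R → ZMod 3) → ℂ) (hsign : ∀ v, H v = 1 ∨ H v = -1) :
    ∑ γ : Fin R → ZMod 3, ‖lcoef H γ‖ ^ 2 = 1 := by
  classical
  -- `‖c‖² = c·conj c`, `conj H = H`, `conj χ(x) = χ(−x)`
  have hreal : ∀ v, (starRingEnd ℂ) (H v) = H v := by
    intro v; rcases hsign v with h | h <;> rw [h] <;> simp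
  have hkey : ∀ γ : Fin R → ZMod 3, ((‖lcoef H γ‖ : ℝ) : ℂ) ^ 2 =
      ((3 : ℂ) ^ R)⁻¹ * ((3 : ℂ) ^ R)⁻¹ * ∑ v : Fin R → ZMod 3, ∑ v' : Fin R → ZMod 3,
        H v * H v' * stdAddChar (∑ j, γ j * (v' j - v j)) := by
    intro γ
    rw [← Complex.mul_conj']
    unfold lcoef
    rw [map_mul, map_inv₀, map_pow]
    have h3 : (starRingEnd ℂ) (3 : ℂ) = 3 := by
      rw [show (3 : ℂ) = ((3 : ℝ) : ℂ) by norm_num, Complex.conj_ofReal]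
    rw [h3, map_sum]
    have e : ∀ v v' : Fin R → ZMod 3, H v * (stdAddChar (-∑ j, γ j * v j) : ℂ) *
        (starRingEnd ℂ) (H v' * stdAddChar (-∑ j, γ j * v' j)) =
        H v * H v' * stdAddChar (∑ j, γ j * (v' j - v j)) := by
      intro v v'
      rw [map_mul, hreal, Literature.Analysis.Fourier.conj_stdAddChar, neg_neg]
      have hchar : (stdAddChar (-∑ j, γ j * v j) : ℂ) * stdAddChar (∑ j, γ j * v' j) =
          stdAddChar (∑ j, γ j * (v' j - v j)) := by
        rw [← AddChar.map_add_eq_mul]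
        congr 1
        rw [neg_add_eq_sub, ← sum_sub_distrib]
        exact sum_congr rfl fun j _ => by ring
      calc H v * (stdAddChar (-∑ j, γ j * v j) : ℂ) * (H v' * stdAddChar (∑ j, γ j * v' j))
          = H v * H v' * ((stdAddChar (-∑ j, γ j * v j) : ℂ) * stdAddChar (∑ j, γ j * v' j)) := by ring
        _ = _ := by rw [hchar]
    have hprod : (∑ v : Fin R → ZMod 3, H v * (stdAddChar (-∑ j, γ j * v j) : ℂ)) *
        (∑ x : Fin R → ZMod 3, (starRingEnd ℂ) (H x * stdAddChar (-∑ j, γ j * x j))) =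
        ∑ v : Fin R → ZMod 3, ∑ v' : Fin R → ZMod 3, H v * H v' * stdAddChar (∑ j, γ j * (v' j - v j)) := by
      rw [Finset.sum_mul_sum]
      exact Finset.sum_congr rfl fun v _ => Finset.sum_congr rfl fun v' _ => e v v'
    rw [← hprod]
    ring
  -- sum over `γ`: orthogonality kills `v' ≠ v`
  apply Complex.ofReal_injective
  push_cast
  rw [Finset.sum_congr rfl fun γ _ => hkey γ, ← Finset.mul_sum, Finset.sum_comm]
  have hinner : ∀ v : Fin R → ZMod 3, (∑ γ : Fin R → ZMod 3, ∑ v' : Fin R → ZMod 3,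
      H v * H v' * (stdAddChar (∑ j, γ j * (v' j - v j)) : ℂ)) = (3 : ℂ) ^ R := by
    intro v
    rw [Finset.sum_comm]
    have horth : ∀ v' : Fin R → ZMod 3, (∑ γ : Fin R → ZMod 3,
        H v * H v' * (stdAddChar (∑ j, γ j * (v' j - v j)) : ℂ)) =
        if v' = v then H v * H v' * (3 : ℂ) ^ R else 0 := by
      intro v'
      rw [← Finset.mul_sum, sum_stdAddChar_dot_eq_ite (fun j => v' j - v j)]
      push_cast
      have hiff : ((fun j => v' j - v j) = 0) ↔ v' = v := by
        constructor
        · intro h0; funext j; exact sub_eq_zero.mp (congrFun h0 j)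
        · rintro rfl; funext j; exact sub_self _
      by_cases hv : v' = v
      · rw [if_pos (hiff.2 hv), if_pos hv]
      · rw [if_neg (fun h0 => hv (hiff.1 h0)), if_neg hv, mul_zero]
    rw [Finset.sum_congr rfl fun v' _ => horth v', Finset.sum_ite_eq' univ v, if_pos (mem_univ v)]
    have hsq : H v * H v = 1 := by rcases hsign v with h | h <;> rw [h] <;> norm_num
    rw [hsq, one_mul]
  rw [Finset.sum_congr rfl fun v _ => hinner v, Finset.sum_const, card_univ, Fintype.card_fun, ZMod.card,
    Fintype.card_fin, nsmul_eq_mul]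
  push_cast
  have h3 : ((3 : ℂ) ^ R) ≠ 0 := pow_ne_zero _ (by norm_num)
  field_simp

end Label

/-! ### The twisted expansion with a label factor -/

section LabelTwist

variable {ι : Type*} [Fintype ι] [DecidableEq ι] {κ : Type*} [Fintype κ] [DecidableEq κ] {R : ℕ}

omit [DecidableEq ι] [Fintype κ] [DecidableEq κ] in
/-- Subset sums are additive in the form. -/
theorem subsetSum_add (f g : ι → ZMod 3) (u : ι → Bool) : subsetSum (f + g) u = subsetSum f u + subsetSum g u := by
  unfold subsetSum
  rw [← sum_add_distrib]
  refine sum_congr rfl fun i _ => ?_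
  by_cases h : u i
  · simp [h]
  · simp [h]

/-- An additive character turns sums into products. -/
private theorem map_sum_eq_prod' {A M : Type*} [AddCommMonoid A] [CommMonoid M] (ψ : AddChar A M)
    {α : Type*} [Fintype α] (f : α → A) : ψ (∑ k, f k) = ∏ k, ψ (f k) := by
  classical
  induction (univ : Finset α) using Finset.induction_on with
  | empty => simp
  | insert j s hj ih => rw [sum_insert hj, prod_insert hj, AddChar.map_add_eq_mul, ih]

/-- **Twisted character expansion with a label factor**: with `h_k(v) = Σ_s a_{k,s}χ₃(sv)` and
`H(v) = Σ_γ b_γ χ₃(⟨γ,v⟩)`,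
`‖Σ_u ∏_k h_k(ℓ_k(u))·H((L_i(u))_i)·χ₂(t)^{|u|}‖ ≤ Σ_{(s,γ)} (∏_k‖a_{k,s_k}‖)‖b_γ‖·∏_c ‖1 + χ₃(λ(s)_c + Λ(γ)_c)χ₂(t)‖`. -/
theorem norm_sum_prod_label_twist_le (δ : κ → ι → ZMod 3) (a h : κ → ZMod 3 → ℂ)
    (hrep : ∀ k v, h k v = ∑ s : ZMod 3, a k s * stdAddChar (s * v))
    (S : Fin R → ι → ZMod 3) (b : (Fin R → ZMod 3) → ℂ) (H : (Fin R → ZMod 3) → ℂ)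
    (hrepH : ∀ v, H v = ∑ γ : Fin R → ZMod 3, b γ * stdAddChar (∑ j, γ j * v j)) (t : ZMod 2) :
    ‖∑ u : ι → Bool, (∏ k, h k (subsetSum (δ k) u)) * H (fun i => subsetSum (S i) u) *
        (stdAddChar t : ℂ) ^ (univ.filter fun i => u i = true).card‖
      ≤ ∑ sγ : (κ → ZMod 3) × (Fin R → ZMod 3), ((∏ k, ‖a k (sγ.1 k)‖) * ‖b sγ.2‖) *
          ∏ i, ‖(1 : ℂ) + stdAddChar (combo δ sγ.1 i + combo S sγ.2 i) * stdAddChar t‖ := by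
  classical
  -- expand the product of tests
  have hexp : ∀ u : ι → Bool, ∏ k, h k (subsetSum (δ k) u)
      = ∑ s : κ → ZMod 3, (∏ k, a k (s k)) * (stdAddChar (subsetSum (combo δ s) u) : ℂ) := by
    intro u
    calc ∏ k, h k (subsetSum (δ k) u)
        = ∏ k, ∑ s : ZMod 3, a k s * (stdAddChar (s * subsetSum (δ k) u) : ℂ) :=
          prod_congr rfl fun k _ => hrep k _
      _ = ∑ s : κ → ZMod 3, ∏ k, a k (s k) * (stdAddChar (s k * subsetSum (δ k) u) : ℂ) :=
          Fintype.prod_sum _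
      _ = _ := by
          refine sum_congr rfl fun s _ => ?_
          rw [prod_mul_distrib, ← map_sum_eq_prod', sum_mul_subsetSum]
  -- expand the label factor
  have hexpH : ∀ u : ι → Bool, H (fun i => subsetSum (S i) u) =
      ∑ γ : Fin R → ZMod 3, b γ * (stdAddChar (subsetSum (combo S γ) u) : ℂ) := by
    intro u
    rw [hrepH]
    refine sum_congr rfl fun γ _ => ?_
    rw [sum_mul_subsetSum]
  -- the summand as a sum over pairs
  have hterm : ∀ u : ι → Bool, (∏ k, h k (subsetSum (δ k) u)) * H (fun i => subsetSum (S i) u) *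
      (stdAddChar t : ℂ) ^ (univ.filter fun i => u i = true).card =
      ∑ sγ : (κ → ZMod 3) × (Fin R → ZMod 3), ((∏ k, a k (sγ.1 k)) * b sγ.2) *
        ((stdAddChar (subsetSum (combo δ sγ.1 + combo S sγ.2) u) : ℂ) *
          (stdAddChar t : ℂ) ^ (univ.filter fun i => u i = true).card) := by
    intro u
    rw [hexp, hexpH, sum_mul_sum, Fintype.sum_prod_type, sum_mul]
    refine sum_congr rfl fun s _ => ?_
    rw [sum_mul]
    refine sum_congr rfl fun γ _ => ?_
    rw [subsetSum_add, AddChar.map_add_eq_mul]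
    ring
  simp_rw [hterm]
  rw [sum_comm]
  simp_rw [← mul_sum]
  refine (norm_sum_le _ _).trans (sum_le_sum fun sγ _ => ?_)
  rw [norm_mul, norm_mul, Complex.norm_prod]
  refine mul_le_mul_of_nonneg_left (le_of_eq ?_) (mul_nonneg (prod_nonneg fun k _ => norm_nonneg _) (norm_nonneg _))
  have h := norm_cubeSum_eq (combo δ sγ.1 + combo S sγ.2) t
  simp only [Pi.add_apply] at h ⊢
  exact h

end LabelTwist

end Summit.QuantumAdvantage.AdviceFreeQNC0.Exp37

end
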